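import Literature.NumberTheory.GaloisRepresentations.HeckeCharacterWeakApproximation   -- ★ `HeckeCharacter.eq_one_of_forall_localUnits` («`K^× 𝕀_K^S` is dense in `𝕀_K`», Tate VII §4 Prop. 4.1), ★ `denseRange_algebraMap_pi_prod`
import Literature.NumberTheory.Automorphic.TorusCharacterLocalComponents                 -- ★ `HeckeCharacter.semilocalComponent`, `semilocalComponent_eq_prod`, `PlacesOver`, `LocalRing`
import HarnessLib

/-!
# R90-TF · S5 — HECKE-CHARACTER RIGIDITY OFF A FINITE SET: two Hecke characters with the same local components at all but finitely many
# finite places are EQUAL (Cassels–Fröhlich Ch. VII (Tate) §4 Prop. 4.1: «`k^* J_k^S` is dense in `J_k`»; Rogawski 1990 §13.3 pp. 202–203)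

Cell `hodgecm-mathlib`, programme R90-TF, section S5 (base `R90-C133`), prover seat R90-C133-p02 (g0), R90-C133-plan (g0) DEAL #9 (2026-09-04T16:08:27Z)
«HECKE-CHARACTER RIGIDITY OFF A FINITE SET — ONE file `Theorems/R90S5HeckeCharacterEqOfCofiniteEq.lean`».  Crux item `stmt-HodgeConjecture-24833` (h413); `--supports` helper
(section-neutral number theory; closes nothing by itself).  PROOF LANE: theorems only (no `def`, no instance, no notation, no `sorry`); imports ★ `Literature` only.

CENSUS (R35, `R90/S5/R90-C133-p02/CENSUS-HeckeRigidity.md`): the dealer's rung (R1) is ALREADY ★ in its strongest useful form — ★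
`Literature.NumberTheory.GaloisRepresentations.HeckeCharacter.eq_one_of_forall_localUnits` (`HeckeCharacterWeakApproximation.lean` :332, PROVED from Mathlib's Artin–Whaples
`AbsoluteValue.denseRange_algebraMap_pi` via ★ `denseRange_algebraMap_pi_prod` = weak approximation at finitely many finite places AND all infinite places): a Hecke character
trivial on `K_vˣ` for every FINITE `v` outside a finite `S` is trivial — NO hypothesis at the infinite places is needed (they are absorbed by the density of `K^× 𝕀_K^S`).  This
file draws the «two characters» corollaries the S5∕S7∕S9 consumers quote, in the tree's two currencies:
* §1 (any number field `K`, ★ `HeckeCharacter.localComponent`): `heckeCharacter_ext_of_localComponent_eq_of_not_mem` — `χ_v = ψ_v` for all finite `v ∉ S` ⇒ `χ = ψ`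
  (apply ★ to `χ ψ⁻¹`); the `∀ᶠ v in cofinite` form `heckeCharacter_ext_of_eventually_localComponent_eq`; the pointwise form `heckeCharacter_ext_of_apply_localUnits_eq_of_not_mem`.
* §2 (CM ∕ quadratic frame `E/F`, ★ `HeckeCharacter.semilocalComponent E v : (E ⊗_F F_v)ˣ →* ℂˣ`, the `μ`-slot currency of ★ `cmXiTorusChar`, S5 D ∕ S9 (S-U) ∕ S7 (J-a″)):
  `localComponent_eq_of_semilocalComponent_eq` (the semi-local component at `v` determines the local components at every `w ∣ v`: evaluate at the unit with `w`-coordinate `a`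
  and `1` elsewhere) and `heckeCharacter_ext_of_semilocalComponent_eq_of_not_mem` — `χ_v = ψ_v` (semi-local) for all finite `v` of `F` outside a finite `S₀` ⇒ `χ = ψ` (the
  places of `E` above `S₀` are finitely many: `PlacesOver E v` is finite); cofinite form `heckeCharacter_ext_of_eventually_semilocalComponent_eq`.
WHY S5 WANTS IT: the global half of every «`P` determines `ξ`» statement of §13.3 (Thm. 13.3.4∕13.3.5 record-level uniqueness behind ★ `APacketEigenvalueGerm.xi_unique_of_germ`;
the H-side twin ★ `OneDimAutRepH.ext_of_xiLocalChar_eq_of_not_mem` already rests on the same ★ density via ★ `TorusCharacterRigidityCofinite`); Rogawski's fixed `μ` and the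
base changes `η̃, ψ̃` are Hecke characters of `E = L`, read place by place through `semilocalComponent`.
HONEST LABEL: HC_CM is proved only modulo the 7 printed citations (2 remaining named inputs: hLiu418 = stmt-HodgeConjecture-24832, h413 = stmt-HodgeConjecture-24833) until rung 0
closes; REL ≠ ★ ≠ BUILT — classical number theory, no leaf moves.

References: [CasselsFrohlichANT1967] J. W. S. Cassels, A. Fröhlich (eds.), *Algebraic Number Theory* (1967): Ch. II (Cassels) §6 Lemma (weak approximation); Ch. VII (Tate) §4
Prop. 4.1 and its proof («`k^* J_k^S` is dense in `J_k`»), §3.2 (local components).  [TateThesis1967] J. Tate, *Fourier analysis in number fields …*, §3.2, §4.3.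
[Rogawski1990] J. Rogawski, *Automorphic Representations of Unitary Groups in Three Variables* (1990), §13.3 Thm. 13.3.4–13.3.5 p. 202; §4.8 p. 51.
-/

set_option autoImplicit false
-- the mandated namespace repeats the single-problem summit's segment (`HodgeConjecture.HodgeConjecture`)
set_option linter.dupNamespace false

noncomputable section

open NumberField IsDedekindDomain Filter
open Literature.NumberTheory.GaloisRepresentations
open Literature.NumberTheory.Automorphic Literature.NumberTheory.Automorphic.UnitaryGroup

namespace Summit.HodgeConjecture.HodgeConjecture.R90.S5

/-! ## §1 Local components off a finite set of finite places determine a Hecke character (any number field) -/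

section AnyField

variable {K : Type} [Field K] [NumberField K]

/-- **TWO HECKE CHARACTERS WITH THE SAME VALUES ON `K_vˣ` FOR ALL FINITE `v` OUTSIDE A FINITE SET ARE EQUAL** (pointwise form): `χ ψ⁻¹` is trivial on every such `K_vˣ`,
hence trivial by ★ `HeckeCharacter.eq_one_of_forall_localUnits` («`K^× 𝕀_K^S` is dense in `𝕀_K`» — weak approximation at `S ∪ ∞`; no hypothesis at the infinite places).
[cite: CasselsFrohlichANT1967, Ch. VII §4 Prop. 4.1 (proof)] -/
theorem heckeCharacter_ext_of_apply_localUnits_eq_of_not_mem {χ ψ : HeckeCharacter K} (S : Finset (HeightOneSpectrum (𝓞 K)))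
    (h : ∀ v : HeightOneSpectrum (𝓞 K), v ∉ S → ∀ u : (v.adicCompletion K)ˣ, χ (localUnits v u) = ψ (localUnits v u)) : χ = ψ := by
  have h1 : χ * ψ⁻¹ = 1 :=
    HeckeCharacter.eq_one_of_forall_localUnits (S := S) fun v hv u => by
      rw [HeckeCharacter.mul_apply, HeckeCharacter.inv_apply, h v hv u, mul_inv_cancel]
  exact mul_inv_eq_one.1 h1

/-- **TWO HECKE CHARACTERS WITH THE SAME LOCAL COMPONENTS `χ_v = ψ_v` (★ `HeckeCharacter.localComponent`) AT ALL FINITE PLACES OUTSIDE A FINITE SET `S` ARE EQUAL**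
— multiplicity one for `GL(1)` in local-component currency. [cite: CasselsFrohlichANT1967, Ch. VII §4 Prop. 4.1 (proof)] [cite: TateThesis1967, §4.3] -/
theorem heckeCharacter_ext_of_localComponent_eq_of_not_mem {χ ψ : HeckeCharacter K} (S : Finset (HeightOneSpectrum (𝓞 K)))
    (h : ∀ v : HeightOneSpectrum (𝓞 K), v ∉ S → χ.localComponent v = ψ.localComponent v) : χ = ψ :=
  heckeCharacter_ext_of_apply_localUnits_eq_of_not_mem S fun v hv u => by
    rw [← HeckeCharacter.localComponent_apply, ← HeckeCharacter.localComponent_apply, h v hv]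

/-- **Cofinite form**: `χ_v = ψ_v` for all but finitely many finite places `v` ⇒ `χ = ψ`. [cite: CasselsFrohlichANT1967, Ch. VII §4 Prop. 4.1 (proof)] -/
theorem heckeCharacter_ext_of_eventually_localComponent_eq {χ ψ : HeckeCharacter K}
    (h : ∀ᶠ v : HeightOneSpectrum (𝓞 K) in cofinite, χ.localComponent v = ψ.localComponent v) : χ = ψ := by
  have hfin : {v : HeightOneSpectrum (𝓞 K) | ¬ (χ.localComponent v = ψ.localComponent v)}.Finite := Filter.eventually_cofinite.1 h
  exact heckeCharacter_ext_of_localComponent_eq_of_not_mem hfin.toFinset fun v hv => by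
    by_contra hne
    exact hv (hfin.mem_toFinset.2 hne)

end AnyField

/-! ## §2 The semi-local currency of a quadratic extension `E/F`: `χ_v = χ ∘ ((E ⊗_F F_v)ˣ → 𝕀_E)` at the finite places `v` of `F` -/

section SemiLocal

variable {F : Type} (E : Type) [Field F] [NumberField F] [Field E] [NumberField E] [Algebra F E]

/-- **The semi-local component at `v` determines the local components at every `w ∣ v`**: `χ_w(a) = χ_v(u)` for the semi-local unit `u` with `w`-coordinate `a` and `1` at the
other places above `v` (★ `semilocalComponent_eq_prod`: `χ_v(u) = ∏_{w ∣ v} χ_w(u_w)`). [cite: TateThesis1967, §3.2, §4.3] -/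
theorem localComponent_eq_of_semilocalComponent_eq {χ ψ : HeckeCharacter E} {v : HeightOneSpectrum (𝓞 F)}
    (h : χ.semilocalComponent E v = ψ.semilocalComponent E v) (w : PlacesOver E v) : χ.localComponent w.1 = ψ.localComponent w.1 := by
  classical
  have key : ∀ (φ : HeckeCharacter E) (a : (w.1.adicCompletion E)ˣ),
      φ.semilocalComponent E v ((MulEquiv.piUnits (M := fun w' : PlacesOver E v => w'.1.adicCompletion E)).symm (Pi.mulSingle w a)) =
        φ.localComponent w.1 a := by
    intro φ a
    rw [semilocalComponent_eq_prod, MulEquiv.apply_symm_apply, Finset.prod_eq_single w (fun w' _ hw' => by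
      rw [Pi.mulSingle_eq_of_ne hw', map_one]) (fun hw => absurd (Finset.mem_univ w) hw), Pi.mulSingle_eq_same]
  refine MonoidHom.ext fun a => ?_
  rw [← key χ a, ← key ψ a, h]

/-- **TWO HECKE CHARACTERS OF `E` WITH THE SAME SEMI-LOCAL COMPONENTS AT ALL FINITE PLACES `v` OF `F` OUTSIDE A FINITE SET `S₀` ARE EQUAL**: by
`localComponent_eq_of_semilocalComponent_eq` they agree at every place `w` of `E` over `v ∉ S₀`; the places over `S₀` are finitely many (`PlacesOver E v` is finite), so §1 applies.
The currency of Rogawski's fixed `μ` and of the base changes `η̃, ψ̃` in S5 D ∕ S9 (★ `cmXiTorusChar (μω.semilocalComponent L v) …`).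
[cite: CasselsFrohlichANT1967, Ch. VII §4 Prop. 4.1 (proof)] [cite: TateThesis1967, §3.2] [cite: Rogawski1990, §4.8 p. 51] -/
theorem heckeCharacter_ext_of_semilocalComponent_eq_of_not_mem {χ ψ : HeckeCharacter E} (S₀ : Finset (HeightOneSpectrum (𝓞 F)))
    (h : ∀ v : HeightOneSpectrum (𝓞 F), v ∉ S₀ → χ.semilocalComponent E v = ψ.semilocalComponent E v) : χ = ψ := by
  classical
  refine heckeCharacter_ext_of_localComponent_eq_of_not_mem
    (S₀.biUnion fun v => (Finset.univ : Finset (PlacesOver E v)).image fun w => w.1) fun w hw => ?_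
  have hv : w.under (𝓞 F) ∉ S₀ := fun hv =>
    hw (Finset.mem_biUnion.2 ⟨w.under (𝓞 F), hv, Finset.mem_image.2 ⟨⟨w, rfl⟩, Finset.mem_univ _, rfl⟩⟩)
  exact localComponent_eq_of_semilocalComponent_eq E (h _ hv) ⟨w, rfl⟩

/-- **Cofinite form (semi-local)**: `χ_v = ψ_v` for all but finitely many finite places `v` of `F` ⇒ `χ = ψ`. [cite: CasselsFrohlichANT1967, Ch. VII §4 Prop. 4.1 (proof)] -/
theorem heckeCharacter_ext_of_eventually_semilocalComponent_eq {χ ψ : HeckeCharacter E}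
    (h : ∀ᶠ v : HeightOneSpectrum (𝓞 F) in cofinite, χ.semilocalComponent E v = ψ.semilocalComponent E v) : χ = ψ := by
  have hfin : {v : HeightOneSpectrum (𝓞 F) | ¬ (χ.semilocalComponent E v = ψ.semilocalComponent E v)}.Finite := Filter.eventually_cofinite.1 h
  exact heckeCharacter_ext_of_semilocalComponent_eq_of_not_mem E hfin.toFinset fun v hv => by
    by_contra hne
    exact hv (hfin.mem_toFinset.2 hne)

end SemiLocal

end Summit.HodgeConjecture.HodgeConjecture.R90.S5

end
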